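import Summits.ResolutionOfSingularities.ResolutionOfSingularities.Theorems.EquisingularLiftEquisingularLiftNatSubmaxLineLinSubst
import HarnessLib

/-!
# [OURS · EL♮(3)] SURFACES IN `ℙ³` WITH A LINE OF SUBMAXIMAL MULTIPLICITY — THE INTRINSIC HYPOTHESIS: a form of degree `d + 2` in
# `(x₂, x₃)^{d+1}` HAS the shape `x₀·A(x₂,x₃) + x₁·B(x₂,x₃) + C(x₂,x₃)`; EL♮ / B‴ / blow-up models for every prime `F ∈ (x₂, x₃)^{deg F − 1}`
# (crux `Theses.EquisingularLift.EquisingularLiftNatThree`, stmt-ResolutionOfSingularities-20148; parent EL♮ stmt-…-20038; stmt-…-15660)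

[OURS · leafhand-res-equisingularlift-7 g0, 2026-08-31; cell `pub/decomp-res`] AI-produced, weaker than expert review; NOT a statement of any
manuscript; nothing here proves resolution of singularities in positive characteristic.  DEF-FREE helper; no `sorry`; standard axioms; ZERO named
hypotheses.

* `le_of_mem_span_pair_pow` — `G ∈ (x₂, x₃)ⁿ` forces `x₂`-`x₃`-degree `≥ n` on every monomial of `G` (induction on `n`, `Submodule.mul_induction_on`);
* ★ `exists_shape_of_mem_pow` — a form `F` of degree `d + 2` in `(x₂, x₃)^{d+1}` IS `x₀·A(x₂,x₃) + x₁·B(x₂,x₃) + C(x₂,x₃)` with `A, B` binary forms of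
  degree `d + 1` and `C` a binary form of degree `d + 2` (sort the monomials by their `x₀x₁`-part, which has degree `≤ 1`);
* ★★ `elNatAt_of_prime_of_mem_pow` / `elnatO_of_prime_of_mem_pow` — for every PRIME form `F` of degree `d + 2` with `F ∈ (x₂, x₃)^{d+1}` over
  `K = K̄` and every `ι : H ⟶ ℙ³` with `range ι = V₊(F)`: `ELNatAt p K 3 H ι` (all `p`) and the stubs' currency `ELNatConclusionO`
  (✓ `SubmaxLine.elNatAt_of_prime`, p822337; ✓ `LinAutTransport.elNatAt_of_range_eq`); ★★ `elNatAt_of_linSubst_mem_pow` — the same after any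
  linear change of coordinates.  **Every integral surface of `ℙ³_K̄` with a line of multiplicity `≥ deg − 1` satisfies EL♮, every `p`.**

References: Hartshorne I Ex. 5.12; The Stacks Project 0804 — through the cited tree files.
-/

set_option linter.dupNamespace false -- mandated namespace `Summit.<Summit>.<Problem>` of this single-conjunct summit

noncomputable section

open CategoryTheory CategoryTheory.Limits AlgebraicGeometry TopologicalSpace
open MvPolynomial
open scoped Pointwise
open Literature.AlgebraicGeometry.Resolution
open Literature.AlgebraicGeometry.Motives Literature.AlgebraicGeometry.Motives.SmoothHypersurface
open Literature.AlgebraicGeometry.Motives.ProjectiveSpace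
open AlgebraicGeometry.Scheme.IdealSheafData

namespace Summit.ResolutionOfSingularities.ResolutionOfSingularities.Cruxes.EquisingularLiftNat.Sections

namespace SubmaxLine

variable (K : Type) [Field K]

/-! ## Monomials of the powers of `(x₂, x₃)` -/

/-- **`G ∈ (x₂, x₃)ⁿ ⟹ every monomial of `G` has `x₂`-`x₃`-degree `≥ n`.** [folklore] -/
theorem le_of_mem_span_pair_pow (n : ℕ) : ∀ G : MvPolynomial (Fin 4) K,
    G ∈ (Ideal.span {(X 2 : MvPolynomial (Fin 4) K), X 3}) ^ n → ∀ s ∈ G.support, n ≤ s 2 + s 3 := by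
  classical
  induction n with
  | zero => intro G _ s _; exact Nat.zero_le _
  | succ n ih =>
    intro G hG
    rw [pow_succ] at hG
    refine Submodule.mul_induction_on hG ?_ ?_
    · intro m hm x hx s hs
      obtain ⟨a, b, rfl⟩ := Ideal.mem_span_pair.mp hx
      rw [mul_add, ← mul_assoc, ← mul_assoc] at hs
      -- `s` is a monomial of `(m a) x₂` or of `(m b) x₃`
      have key : ∀ (q : MvPolynomial (Fin 4) K) (i : Fin 4), i = 2 ∨ i = 3 → s ∈ (m * q * X i).support → n + 1 ≤ s 2 + s 3 := by
        intro q i hi hs'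
        rw [support_mul_X, Finset.mem_map] at hs'
        obtain ⟨t, ht, rfl⟩ := hs'
        have ht' := support_mul m q ht
        rw [Finset.mem_add] at ht'
        obtain ⟨u, hu, v, -, rfl⟩ := ht'
        have hu' := ih m hm u hu
        simp only [addRightEmbedding_apply, Finsupp.coe_add, Pi.add_apply]
        rcases hi with rfl | rfl
        · simp only [Finsupp.single_apply]
          simp
          omega
        · simp only [Finsupp.single_apply]
          simp
          omega
      rcases Finset.mem_union.mp (support_add hs) with h2 | h3
      · exact key a 2 (Or.inl rfl) h2
      · exact key b 3 (Or.inr rfl) h3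
    · intro x y hx hy s hs
      rcases Finset.mem_union.mp (support_add hs) with h | h
      · exact hx s h
      · exact hy s h

/-! ## The shape `x₀·A + x₁·B + C` -/

/-- The total degree of a monomial exponent on `Fin 4` is the sum of its four entries. [folklore] -/
theorem sum_support_eq (s : Fin 4 →₀ ℕ) : ∑ i ∈ s.support, s i = s 0 + s 1 + s 2 + s 3 := by
  classical
  rw [Finset.sum_subset (Finset.subset_univ s.support) (fun i _ hi => Finsupp.notMem_support_iff.mp hi), Fin.sum_univ_four]

/-- ★ **A form of degree `d + 2` in `(x₂, x₃)^{d+1}` has the shape `x₀·A(x₂,x₃) + x₁·B(x₂,x₃) + C(x₂,x₃)`** with `A, B` binary forms of degree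
`d + 1` and `C` a binary form of degree `d + 2`: each monomial has `x₀x₁`-part of degree `≤ 1`, sort accordingly. [folklore] -/
theorem exists_shape_of_mem_pow {d : ℕ} (F : MvPolynomial (Fin 4) K) (hF : F.IsHomogeneous (d + 2))
    (hmem : F ∈ (Ideal.span {(X 2 : MvPolynomial (Fin 4) K), X 3}) ^ (d + 1)) :
    ∃ A B C : MvPolynomial (Fin 2) K, A.IsHomogeneous (d + 1) ∧ B.IsHomogeneous (d + 1) ∧ C.IsHomogeneous (d + 2) ∧
      F = X 0 * rename (![2, 3] : Fin 2 → Fin 4) A + X 1 * rename (![2, 3] : Fin 2 → Fin 4) B +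
        rename (![2, 3] : Fin 2 → Fin 4) C := by
  classical
  have hsupp : ∀ s ∈ F.support, d + 1 ≤ s 2 + s 3 := le_of_mem_span_pair_pow K (d + 1) F hmem
  have hdeg : ∀ s ∈ F.support, s 0 + s 1 + s 2 + s 3 = d + 2 := fun s hs => by
    rw [← sum_support_eq, ← hF.degree_eq_sum_deg_support hs]
  -- the projection of an exponent to its `x₂x₃`-part, read on `Fin 2`
  let π : (Fin 4 →₀ ℕ) → (Fin 2 →₀ ℕ) := fun s => Finsupp.single 0 (s 2) + Finsupp.single 1 (s 3)
  have hπmap : ∀ s, (π s).mapDomain (![2, 3] : Fin 2 → Fin 4) = Finsupp.single 2 (s 2) + Finsupp.single 3 (s 3) := by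
    intro s
    simp only [π, Finsupp.mapDomain_add, Finsupp.mapDomain_single, Matrix.cons_val_zero, Matrix.cons_val_one]
  have hπdeg : ∀ s, (π s).degree = s 2 + s 3 := by
    intro s
    simp only [π, map_add, Finsupp.degree_single]
  have hren : ∀ s (c : K), rename (![2, 3] : Fin 2 → Fin 4) (monomial (π s) c) =
      monomial (Finsupp.single 2 (s 2) + Finsupp.single 3 (s 3)) c := by
    intro s c
    rw [rename_monomial, hπmap]
  -- termwise identities
  have hX : ∀ (i : Fin 4) (m : Fin 4 →₀ ℕ) (c : K), (X i : MvPolynomial (Fin 4) K) * monomial m c = monomial (Finsupp.single i 1 + m) c := by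
    intro i m c
    rw [X, monomial_mul, one_mul]
  have hcase : ∀ s ∈ F.support,
      monomial s (coeff s F) =
        (if s 0 = 1 then X 0 * rename (![2, 3] : Fin 2 → Fin 4) (monomial (π s) (coeff s F)) else 0) +
        (if s 1 = 1 then X 1 * rename (![2, 3] : Fin 2 → Fin 4) (monomial (π s) (coeff s F)) else 0) +
        (if s 0 = 0 ∧ s 1 = 0 then rename (![2, 3] : Fin 2 → Fin 4) (monomial (π s) (coeff s F)) else 0) := by
    intro s hs
    have h1 := hsupp s hs
    have h2 := hdeg s hs
    have h01 : s 0 + s 1 ≤ 1 := by omega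
    by_cases hs0 : s 0 = 1
    · have hs1 : s 1 = 0 := by omega
      have hse : s = Finsupp.single 0 1 + (Finsupp.single 2 (s 2) + Finsupp.single 3 (s 3)) := by
        ext i
        fin_cases i <;> simp [hs0, hs1]
      rw [if_pos hs0, if_neg (by omega), if_neg (by omega), add_zero, add_zero, hren, hX, ← hse]
    · by_cases hs1 : s 1 = 1
      · have hs0' : s 0 = 0 := by omega
        have hse : s = Finsupp.single 1 1 + (Finsupp.single 2 (s 2) + Finsupp.single 3 (s 3)) := by
          ext i
          fin_cases i <;> simp [hs0', hs1]
        rw [if_neg hs0, if_pos hs1, if_neg (by omega), zero_add, add_zero, hren, hX, ← hse]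
      · have hs0' : s 0 = 0 := by omega
        have hs1' : s 1 = 0 := by omega
        have hse : s = Finsupp.single 2 (s 2) + Finsupp.single 3 (s 3) := by
          ext i
          fin_cases i <;> simp [hs0', hs1']
        rw [if_neg hs0, if_neg hs1, if_pos ⟨hs0', hs1'⟩, zero_add, zero_add, hren, ← hse]
  refine ⟨∑ s ∈ F.support with s 0 = 1, monomial (π s) (coeff s F),
    ∑ s ∈ F.support with s 1 = 1, monomial (π s) (coeff s F),
    ∑ s ∈ F.support with (s 0 = 0 ∧ s 1 = 0), monomial (π s) (coeff s F), ?_, ?_, ?_, ?_⟩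
  · refine IsHomogeneous.sum _ _ _ fun s hs => isHomogeneous_monomial _ ?_
    obtain ⟨hs, hs0⟩ := Finset.mem_filter.mp hs
    rw [hπdeg]
    have := hsupp s hs; have := hdeg s hs; omega
  · refine IsHomogeneous.sum _ _ _ fun s hs => isHomogeneous_monomial _ ?_
    obtain ⟨hs, hs1⟩ := Finset.mem_filter.mp hs
    rw [hπdeg]
    have := hsupp s hs; have := hdeg s hs; omega
  · refine IsHomogeneous.sum _ _ _ fun s hs => isHomogeneous_monomial _ ?_
    obtain ⟨hs, hs01⟩ := Finset.mem_filter.mp hs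
    rw [hπdeg]
    have := hsupp s hs; have := hdeg s hs; omega
  · rw [map_sum, map_sum, map_sum, Finset.mul_sum, Finset.mul_sum, Finset.sum_filter, Finset.sum_filter, Finset.sum_filter,
      ← Finset.sum_add_distrib, ← Finset.sum_add_distrib]
    conv_lhs => rw [F.as_sum]
    exact Finset.sum_congr rfl fun s hs => hcase s hs

/-! ## The certificates for prime forms in `(x₂, x₃)^{deg − 1}`, for any embedding with the same image -/

section Prime

variable [IsAlgClosed K] {d : ℕ} (F : MvPolynomial (Fin 4) K) (hF : F.IsHomogeneous (d + 2)) (hprime : Prime F)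
  (hmem : F ∈ (Ideal.span {(X 2 : MvPolynomial (Fin 4) K), X 3}) ^ (d + 1))
  {H : Scheme.{0}} (ι : H ⟶ (projectiveSpace 3 K).left)
  (hrange : letI := MvPolynomial.gradedAlgebra (σ := Fin 4) (R := K)
    Set.range ι = {x : Proj (homogeneousSubmodule (Fin 4) K) | F ∈ x.asHomogeneousIdeal})

include hF hprime hmem hrange in
/-- ★★ **EL♮ FOR EVERY PRIME FORM `F` OF DEGREE `d + 2` IN `(x₂, x₃)^{d+1}`, ANY EMBEDDING WITH IMAGE `V₊(F)`** — every integral surface of `ℙ³_K̄`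
whose multiplicity along the line `V(x₂, x₃)` is at least `deg F − 1`: `ELNatAt p K 3 H ι`, ANY `p` (✓ `exists_shape_of_mem_pow`,
✓ `elNatAt_of_prime`, ✓ `LinAutTransport.elNatAt_of_range_eq`). [OURS · lh7] [cite: Hartshorne1977, I Ex. 5.12] -/
theorem elNatAt_of_prime_of_mem_pow (p : ℕ) (hp : p.Prime) [CharP K p] : Theorems.EquisingularLift.ELNatAt p K 3 H ι := by
  letI := MvPolynomial.gradedAlgebra (σ := Fin 4) (R := K)
  obtain ⟨A, B, C, hA, hB, hC, hFeq⟩ := exists_shape_of_mem_pow K F hF hmem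
  refine LinAutTransport.elNatAt_of_range_eq p K 3 ι (hypersurfaceι F).left ?_ (elNatAt_of_prime K A B C hA hB hC F hFeq p hp hprime)
  rw [hrange]
  exact QuadricELNat.setOf_mem_eq_range_hypersurfaceι (n := 2) F

include hF hprime hmem hrange in
/-- ★ **The same in the stubs' currency** `ELNatConclusionO K 3 H ι` (`ι` a closed immersion, `H` integral). [OURS · lh7] -/
theorem elnatO_of_prime_of_mem_pow (p : ℕ) (hp : p.Prime) [CharP K p] (hι : IsClosedImmersion ι) (hH : IsIntegral H) :
    ELNatConclusionO K 3 H ι :=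
  RouteCurrency.elnatO_of_elNatAt p hp K 3 H ι hι hH (elNatAt_of_prime_of_mem_pow K F hF hprime hmem ι hrange p hp)

end Prime

/-- ★★ **EL♮ FOR EVERY INTEGRAL SURFACE WITH A LINE OF SUBMAXIMAL MULTIPLICITY, IN ANY COORDINATES** — the intrinsic form of
`elNatAt_of_linSubst_submaxLine`: mutually inverse linear substitutions `τ, τ'`, a closed immersion `ι : H ⟶ ℙ³_k` with `range ι = V₊(F)`, `F` prime
and homogeneous of degree `d + 2` with `σ_{τ'} F ∈ (x₂, x₃)^{d+1}` (i.e. `F` has multiplicity `≥ d + 1` along the line `σ_{τ'}⁻¹ V(x₂, x₃)`):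
`ELNatAt p k 3 H ι`, ANY `p`. [OURS · lh7] [cite: Hartshorne1977, I Ex. 5.12] -/
theorem elNatAt_of_linSubst_mem_pow {k : Type} [Field k] (p : ℕ) (hp : p.Prime) [CharP k p] [IsAlgClosed k]
    (τ τ' : Fin (2 + 1 + 1) → MvPolynomial (Fin (2 + 1 + 1)) k)
    (hτ : ∀ i, (τ i).IsHomogeneous 1) (hτ' : ∀ i, (τ' i).IsHomogeneous 1)
    (hinv : ∀ i, aeval τ (τ' i) = X i) (hinv' : ∀ i, aeval τ' (τ i) = X i)
    {d : ℕ} {H : Scheme.{0}} (ι : H ⟶ (projectiveSpace (2 + 1) k).left) [IsClosedImmersion ι] (F : MvPolynomial (Fin (2 + 1 + 1)) k)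
    (hprime : Prime F) (hF : (aeval τ' F).IsHomogeneous (d + 2))
    (hmem : aeval τ' F ∈ (Ideal.span {(X 2 : MvPolynomial (Fin 4) k), X 3}) ^ (d + 1))
    (hrange : letI := MvPolynomial.gradedAlgebra (σ := Fin (2 + 1 + 1)) (R := k)
      Set.range ι = {x : Proj (homogeneousSubmodule (Fin (2 + 1 + 1)) k) | F ∈ x.asHomogeneousIdeal}) :
    Theorems.EquisingularLift.ELNatAt p k (2 + 1) H ι := by
  obtain ⟨A, B, C, hA, hB, hC, hFeq⟩ := exists_shape_of_mem_pow k (aeval τ' F) hF hmem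
  exact elNatAt_of_linSubst_submaxLine p hp τ τ' hτ hτ' hinv hinv' A B C hA hB hC ι F hprime hFeq hrange

end SubmaxLine

end Summit.ResolutionOfSingularities.ResolutionOfSingularities.Cruxes.EquisingularLiftNat.Sections

end
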